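import Mathlib
import HarnessLib

/-!
# Stub `stub_C3` for the line `BaireSketch` of the crux `HeckeEigenvalueField` (stmt-Langlands-13632)

Pure linear algebra: for a finite-dimensional subspace `X` of a `ℂ`-vector space `V` stable under a
family of endomorphisms `T i`, only finitely many "eigencharacters on stable subquotients of `X`"
`χ : ι → ℂ` occur.  Proof: the restrictions `T i|X` generate a finite-dimensional subalgebra `A` of
`Module.End ℂ X`; an eigencharacter `χ` (with eigenvector `y` modulo a stable subspace `Y'`) is the
restriction to the generators of a `ℂ`-algebra homomorphism `A →ₐ[ℂ] ℂ` (the scalar by which `A`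
acts on the line spanned by `y` modulo `Y'`), and there are only finitely many such homomorphisms
(`minpoly.AlgHom.fintype`).
-/

set_option linter.dupNamespace false

noncomputable section

namespace Summit.Langlands.Langlands.Theorems.HeckeEigenvalueField.Baire

/-- If `x ∉ P`, the scalar `c` with `v - c • x ∈ P` is unique. [folklore] -/
theorem scalar_unique_of_notMem {X : Type*} [AddCommGroup X] [Module ℂ X]
    {P : Submodule ℂ X} {x v : X} (hx : x ∉ P) {c d : ℂ}
    (hc : v - c • x ∈ P) (hd : v - d • x ∈ P) : c = d := by
  by_contra hcd
  apply hx
  have h1 : (d - c) • x ∈ P := by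
    convert P.sub_mem hc hd using 1
    rw [sub_smul]
    abel
  have h2 := P.smul_mem (d - c)⁻¹ h1
  rwa [inv_smul_smul₀ (sub_ne_zero.mpr (Ne.symm hcd))] at h2

/-- Let `A` be a subalgebra of `Module.End ℂ X` each of whose elements preserves the subspace `P`
and has `x ∉ P` as an eigenvector modulo `P`.  Then the eigenvalue modulo `P` is a `ℂ`-algebra
homomorphism `A →ₐ[ℂ] ℂ`. [folklore] -/
theorem exists_algHom_eigenvalue_mod {X : Type*} [AddCommGroup X] [Module ℂ X]
    (P : Submodule ℂ X) (x : X) (hx : x ∉ P) (A : Subalgebra ℂ (Module.End ℂ X))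
    (hP : ∀ a ∈ A, ∀ v ∈ P, a v ∈ P) (hx' : ∀ a ∈ A, ∃ c : ℂ, a x - c • x ∈ P) :
    ∃ f : A →ₐ[ℂ] ℂ, ∀ a : A, (a : Module.End ℂ X) x - f a • x ∈ P := by
  choose c hc using fun a : A => hx' a.1 a.2
  have huniq : ∀ (a : A) (d : ℂ), (a : Module.End ℂ X) x - d • x ∈ P → c a = d :=
    fun a d hd => scalar_unique_of_notMem hx (hc a) hd
  refine ⟨{ toFun := c
            map_one' := huniq 1 1 (by simp)
            map_mul' := fun a b => huniq (a * b) (c a * c b) ?_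
            map_zero' := huniq 0 0 (by simp)
            map_add' := fun a b => huniq (a + b) (c a + c b) ?_
            commutes' := fun r => huniq _ _ (by simp) }, hc⟩
  · -- multiplicativity
    have h : ((a * b : A) : Module.End ℂ X) x - (c a * c b) • x =
        (a : Module.End ℂ X) ((b : Module.End ℂ X) x - c b • x) +
          c b • ((a : Module.End ℂ X) x - c a • x) := by
      rw [map_sub, map_smul, smul_sub, smul_smul, mul_comm (c b) (c a), Subalgebra.coe_mul,
        Module.End.mul_apply]
      abel
    rw [h]
    exact P.add_mem (hP _ a.2 _ (hc b)) (P.smul_mem _ (hc a))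
  · -- additivity
    have h : ((a + b : A) : Module.End ℂ X) x - (c a + c b) • x =
        ((a : Module.End ℂ X) x - c a • x) + ((b : Module.End ℂ X) x - c b • x) := by
      rw [Subalgebra.coe_add, LinearMap.add_apply, add_smul]
      abel
    rw [h]
    exact P.add_mem (hc a) (hc b)

/-- **(C3) stub.** For a finite-dimensional subspace `X` stable under the endomorphisms `T i`,
only finitely many functions `χ : ι → ℂ` occur as the eigencharacter of the `T i` on a vector
`y ∈ Y` modulo `Y'`, for `T`-stable subspaces `Y, Y' ≤ X` with `y ∉ Y'`. [folklore] -/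
theorem stub_C3 {V : Type*} [AddCommGroup V] [Module ℂ V] (X : Submodule ℂ V)
    [FiniteDimensional ℂ X] {ι : Type*} (T : ι → Module.End ℂ V)
    (hT : ∀ i, ∀ x ∈ X, T i x ∈ X) :
    Set.Finite {χ : ι → ℂ | ∃ (Y Y' : Submodule ℂ V), Y ≤ X ∧ Y' ≤ X ∧
      (∀ i, ∀ y ∈ Y, T i y ∈ Y) ∧ (∀ i, ∀ y ∈ Y', T i y ∈ Y') ∧
      ∃ y ∈ Y, y ∉ Y' ∧ ∀ i, T i y - χ i • y ∈ Y'} := by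
  classical
  -- the restrictions of the `T i` to `X` and the (finite-dimensional) subalgebra they generate
  let S : ι → Module.End ℂ X := fun i => (T i).restrict (hT i)
  let A : Subalgebra ℂ (Module.End ℂ X) := Algebra.adjoin ℂ (Set.range S)
  have hSA : ∀ i, S i ∈ A := fun i => Algebra.subset_adjoin (Set.mem_range_self i)
  let Φ : (A →ₐ[ℂ] ℂ) → ι → ℂ := fun f i => f ⟨S i, hSA i⟩
  refine (Set.finite_range Φ).subset ?_
  rintro χ ⟨Y, Y', hYX, -, -, hTY', y, hy, hyY', hχ⟩
  -- work inside `X`: `P` is `Y'` seen in `X`, `x` is `y` seen in `X`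
  let P : Submodule ℂ X := Y'.comap X.subtype
  let x : X := ⟨y, hYX hy⟩
  have hxP : x ∉ P := hyY'
  have hSP : ∀ i, ∀ v ∈ P, S i v ∈ P := fun i v hv => by
    simp only [P, Submodule.mem_comap, Submodule.subtype_apply, S, LinearMap.coe_restrict_apply]
    exact hTY' i v hv
  have hSx : ∀ i, S i x - χ i • x ∈ P := fun i => by
    simp only [P, Submodule.mem_comap, Submodule.subtype_apply, Submodule.coe_sub,
      Submodule.coe_smul, S, LinearMap.coe_restrict_apply]
    exact hχ i
  -- the subalgebra of endomorphisms of `X` preserving `P` with `x` as an eigenvector modulo `P`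
  let B : Subalgebra ℂ (Module.End ℂ X) :=
    { carrier := {a | (∀ v ∈ P, a v ∈ P) ∧ ∃ c : ℂ, a x - c • x ∈ P}
      mul_mem' := by
        rintro a b ⟨ha, ca, ha'⟩ ⟨hb, cb, hb'⟩
        refine ⟨fun v hv => ha _ (hb v hv), ca * cb, ?_⟩
        have h : (a * b) x - (ca * cb) • x = a (b x - cb • x) + cb • (a x - ca • x) := by
          rw [map_sub, map_smul, smul_sub, smul_smul, mul_comm cb ca, Module.End.mul_apply]
          abel
        rw [h]
        exact P.add_mem (ha _ hb') (P.smul_mem _ ha')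
      add_mem' := by
        rintro a b ⟨ha, ca, ha'⟩ ⟨hb, cb, hb'⟩
        refine ⟨fun v hv => P.add_mem (ha v hv) (hb v hv), ca + cb, ?_⟩
        have h : (a + b) x - (ca + cb) • x = (a x - ca • x) + (b x - cb • x) := by
          rw [LinearMap.add_apply, add_smul]
          abel
        rw [h]
        exact P.add_mem ha' hb'
      algebraMap_mem' := fun r => ⟨fun v hv => by simpa using P.smul_mem r hv, r, by simp⟩ }
  have hAB : A ≤ B := Algebra.adjoin_le (by
    rintro _ ⟨i, rfl⟩
    exact ⟨hSP i, χ i, hSx i⟩)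
  obtain ⟨f, hf⟩ := exists_algHom_eigenvalue_mod P x hxP A (fun a ha => (hAB ha).1)
    (fun a ha => (hAB ha).2)
  exact ⟨f, funext fun i => scalar_unique_of_notMem hxP (hf ⟨S i, hSA i⟩) (hSx i)⟩

end Summit.Langlands.Langlands.Theorems.HeckeEigenvalueField.Baire

end
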